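import Literature.MathematicalPhysics.QuantumLattice.MatrixProductStatesProofs
import HarnessLib

/-!
# The intersection property of matrix product states (Fannes–Nachtergaele–Werner, Lemma 5.5)

Trunk **T-QLATTICE**. Sibling proof file of
`Literature/MathematicalPhysics/QuantumLattice/MatrixProductStates.lean` (next to
`MatrixProductStatesProofs.lean`, `MatrixProductStatesGroundStateProofs.lean`, …). Theorems only:
no statement or definition of `MatrixProductStates` is changed and no definition is introduced.
It provides the tensor-generic half of the uniqueness theorem for the AKLT ring
(`aklt_unique_periodic`, discharged in `SpinChainsAkltUniqueProofs.lean`):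

* `eq_of_trace_mul_wordProduct_eq` — injectivity of `B ↦ ψ_B = tr (B A^{w})` on `ℓ` sites when
  the words of length `ℓ` span `M_D(ℂ)` (`IsInjectiveMPS A ℓ`);
* `exists_eq_smul_one_of_commute_wordProduct` — a matrix commuting with all words of a spanning
  length is a scalar;
* `exists_boundary_of_snoc_of_cons` — **FNW Lemma 5.5, inductive step**: if `ψ` on `m + 2`
  sites is a boundary MPS in its first `m + 1` letters for every frozen last letter and in its
  last `m + 1` letters for every frozen first letter, and the words of length `m` span, then
  `ψ = ψ_X` on all `m + 2` sites (`𝒢_{m+2} = 𝒢_{m+1} ⊗ ℋ ∩ ℋ ⊗ 𝒢_{m+1}`);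
* `exists_boundary_of_twoSiteSlices` — the iterated form for a nearest-neighbour (`ℓ = 2`)
  exposing interaction: for a tensor injective at length `2` with `Σ_s A^s A^{s†} = 𝟙` and
  satisfying the intersection property at `ℓ = 2` (a hypothesis, `h3`), every vector on `n ≥ 2`
  sites all of whose two-site bond slices lie in `𝒢₂` is a boundary MPS on `n` sites, i.e.
  `ker H_{1,…,n} = ⋂_j ker h_{j,j+1} = 𝒢_n`.

## Source

M. Fannes, B. Nachtergaele, R. F. Werner, *Finitely correlated states on quantum spin chains*,
Comm. Math. Phys. **144** (1992) 443–490 (held: `paper:doi-10-1007-bf02099178`), §5,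
pp. 468–469. P. 468: "The kernel of `H_{{1,…,m}}` is clearly equal to the intersection of the
kernels of the positive operators `h_k`. … The following lemma asserts that these two spaces
are, in fact, equal." **Lemma 5.5** (p. 468): for `m ≥ ℓ ≥ ℓ₀ (+1)`,
`𝒢_m = ⋂_s ℋ^{⊗s} ⊗ 𝒢_ℓ ⊗ ℋ^{⊗(m-ℓ-s)}`; proof (pp. 468–469): "Proceeding by induction over
`m` … we have to show that `𝒢_{ℓ+1} = 𝒢_ℓ ⊗ ℋ ∩ ℋ ⊗ 𝒢_ℓ`, provided that … `Γ_{ℓ-1}` is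
injective, i.e. that `Tr (B v(μ_{ℓ-1})^* ⋯ v(μ₁)^*) = 0` for all `(ℓ-1)`-tuples implies `B = 0`.
… the expression in braces must vanish for all `μ_{ℓ+1}, μ₁`. Hence using (5.3.b):
`B(μ) = Σ_ν v(ν)v(ν)^* B(μ) = Σ_ν v(ν) C(ν) v(μ)^* = D v(μ)^*` with `D = Σ_ν v(ν)C(ν)`. Hence
`Φ = Γ_{ℓ+1}(D) ∈ 𝒢_{ℓ+1}`." P. 471: "If the interaction length of `ω` is `ℓ₀`, there always
exists an interaction `h` of range `ℓ₀ + 1` exposing `ω`. … In some cases the intersection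
property of Lemma 5.5 already holds for `ℓ = ℓ₀`" — which is why the `ℓ = 2` step is a
hypothesis here (it is verified for the AKLT tensor in `MatrixProductStatesAkltChainProofs`).
The scalar lemma is the last step of D. Perez-Garcia, F. Verstraete, M. M. Wolf, J. I. Cirac,
QIC **7** (2007) 401, §4.1.2, Theorem 10 ("`X` commutes with every matrix and hence `X = λ𝟙`").

In our conventions `A^s` plays the role of `v(s)^*` read in the opposite order, `ψ_B(σ) =
tr (B A^{σ₀} ⋯ A^{σ_{n-1}})` (`mpsWithBoundary`), and the normalisation (5.3.b) is
`Σ_s A^s (A^s)† = 𝟙` (`transferOp A 1 = 1`).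

## Proof sketch

`exists_boundary_of_snoc_of_cons`: with `B_t`, `C_s` the boundary matrices of the two
restrictions, evaluating `ψ` on `s w t` both ways gives `tr ((B_t A^s) A^w) = tr ((A^t C_s) A^w)`
for all words `w` of length `m`, so `B_t A^s = A^t C_s` (`eq_of_trace_mul_wordProduct_eq`, via
Mathlib's `Matrix.ext_iff_trace_mul_right`), then `B_t = B_t Σ_s A^s A^{s†} = A^t X`,
`X = Σ_s C_s A^{s†}`, and `ψ(w t) = tr (B_t A^w) = tr (X A^w A^t)`. The iteration
`exists_boundary_of_twoSiteSlices` is `Nat.le_induction` from `n = 2`; the two-site-slice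
hypothesis restricts to frozen last/first letters (`twoSiteSlices_snoc`, `twoSiteSlices_cons`),
the step `2 → 3` is the hypothesis `h3`, and the steps `n → n + 1`, `n ≥ 3`, use injectivity at
length `n - 1 ≥ 2` (`IsInjectiveMPS.of_le`).

## References

* M. Fannes, B. Nachtergaele, R. F. Werner, Comm. Math. Phys. **144** (1992) 443–490,
  doi:10.1007/bf02099178, §5 Lemma 5.5 (pp. 468–469), p. 471. [FannesNachtergaeleWernerCMP1992]
* D. Perez-Garcia, F. Verstraete, M. M. Wolf, J. I. Cirac, Quantum Inf. Comput. **7** (2007)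
  401–430, arXiv:quant-ph/0608197, §4.1.1 Theorem 9, §4.1.2 Theorem 10.
  [PerezGarciaVerstraeteWolfCiracQIC2007]
-/

noncomputable section

open Matrix

namespace Literature.MathematicalPhysics.QuantumLattice

section QLattice

variable {q D : ℕ}

/-! ### Word products: appending a letter, trace pairing, centrality -/

/-- Appending a letter multiplies the word product on the right:
`A^{w₀} ⋯ A^{w_{k-1}} · A^{i}` is the word product of `Fin.snoc w i`. [folklore] -/
theorem wordProduct_snoc {k : ℕ} (A : MPSTensor q D) (w : Fin k → Fin q) (i : Fin q) :
    wordProduct A (Fin.snoc w i : Fin (k + 1) → Fin q) = wordProduct A w * A i := by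
  simp only [wordProduct]
  rw [List.ofFn_succ']
  simp [Fin.snoc_castSucc, Fin.snoc_last]

/-- **Injectivity of `Γ_ℓ` in trace-pairing form.** If the words of length `ℓ` span `M_D(ℂ)`
(`IsInjectiveMPS A ℓ`), a matrix `X` is determined by the amplitudes `tr (X A^{w})`,
`w` of length `ℓ`, i.e. `B ↦ ψ_B` is injective on `ℓ` sites. Fannes–Nachtergaele–Werner (1992)
§5, proof of Lemma 5.5 ("`Tr (B v(μ_{ℓ-1})^* ⋯ v(μ₁)^*) = 0` for all tuples implies `B = 0`").
[cite: FannesNachtergaeleWernerCMP1992, §5 Lemma 5.5] -/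
theorem eq_of_trace_mul_wordProduct_eq {A : MPSTensor q D} {ℓ : ℕ} (h : IsInjectiveMPS A ℓ)
    {X Y : Matrix (Fin D) (Fin D) ℂ}
    (hXY : ∀ w : Fin ℓ → Fin q, (X * wordProduct A w).trace = (Y * wordProduct A w).trace) :
    X = Y := by
  refine Matrix.ext_iff_trace_mul_right.2 fun Z => ?_
  have hZ : Z ∈ Submodule.span ℂ (Set.range (wordProduct (ℓ := ℓ) A)) := by
    rw [h]; exact Submodule.mem_top
  induction hZ using Submodule.span_induction with
  | mem x hx =>
    obtain ⟨w, rfl⟩ := hx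
    exact hXY w
  | zero => simp
  | add x y _ _ hx hy => rw [mul_add, mul_add, trace_add, trace_add, hx, hy]
  | smul c x _ hx => rw [mul_smul_comm, mul_smul_comm, trace_smul, trace_smul, hx]

/-- A matrix commuting with all word products of a spanning length is a scalar (it is then
central in `M_D(ℂ)`). Perez-Garcia–Verstraete–Wolf–Cirac (2007) §4.1.2, proof of Theorem 10
("`X` commutes with every matrix and hence `X = λ𝟙`").
[cite: PerezGarciaVerstraeteWolfCiracQIC2007, §4.1.2 Theorem 10] -/
theorem exists_eq_smul_one_of_commute_wordProduct {A : MPSTensor q D} {ℓ : ℕ}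
    (h : IsInjectiveMPS A ℓ) {X : Matrix (Fin D) (Fin D) ℂ}
    (hX : ∀ w : Fin ℓ → Fin q, X * wordProduct A w = wordProduct A w * X) :
    ∃ c : ℂ, X = c • (1 : Matrix (Fin D) (Fin D) ℂ) := by
  have hall : ∀ Z : Matrix (Fin D) (Fin D) ℂ, Commute Z X := by
    intro Z
    have hZ : Z ∈ Submodule.span ℂ (Set.range (wordProduct (ℓ := ℓ) A)) := by
      rw [h]; exact Submodule.mem_top
    induction hZ using Submodule.span_induction with
    | mem x hx =>
      obtain ⟨w, rfl⟩ := hx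
      exact (hX w).symm
    | zero => exact Commute.zero_left X
    | add x y _ _ hx hy => exact hx.add_left hy
    | smul c x _ hx => exact hx.smul_left c
  obtain ⟨c, hc⟩ := Matrix.mem_range_scalar_iff_commute_single'.2 fun i j => hall _
  exact ⟨c, by rw [← hc, Matrix.scalar_apply, smul_one_eq_diagonal]⟩

/-! ### The inductive step of the intersection property (FNW Lemma 5.5) -/

/-- **Fannes–Nachtergaele–Werner, Lemma 5.5 (inductive step of the intersection property
`𝒢_{m+2} = 𝒢_{m+1} ⊗ ℋ ∩ ℋ ⊗ 𝒢_{m+1}`).** Let the words of length `m` span `M_D(ℂ)` and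
`Σ_s A^s (A^s)† = 𝟙`. If a vector `ψ` on `m + 2` sites is, for each frozen last letter `t`, a
boundary MPS `ψ_{B_t}` in the first `m + 1` letters, and for each frozen first letter `s` a
boundary MPS `ψ_{C_s}` in the last `m + 1` letters, then `ψ = ψ_X` on all `m + 2` sites.
Proof as printed: comparing the two expressions on words `s w t`,
`tr (B_t A^s A^w) = tr (C_s A^w A^t)` for all `w` of length `m`, so `B_t A^s = A^t C_s` by
injectivity, whence `B_t = Σ_s B_t A^s A^{s†} = A^t D` with `D = Σ_s C_s A^{s†}`, and
`ψ = ψ_D`. Fannes–Nachtergaele–Werner, CMP 144 (1992), Lemma 5.5, pp. 468–469.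
[cite: FannesNachtergaeleWernerCMP1992, §5 Lemma 5.5] -/
theorem exists_boundary_of_snoc_of_cons {A : MPSTensor q D} {m : ℕ} (hinj : IsInjectiveMPS A m)
    (hnorm : ∑ s : Fin q, A s * (A s)ᴴ = 1) (ψ : (Fin (m + 2) → Fin q) → ℂ)
    (hB : ∀ t : Fin q, ∃ B : Matrix (Fin D) (Fin D) ℂ, ∀ w : Fin (m + 1) → Fin q,
      ψ (Fin.snoc w t) = mpsWithBoundary (m + 1) A B w)
    (hC : ∀ s : Fin q, ∃ C : Matrix (Fin D) (Fin D) ℂ, ∀ w : Fin (m + 1) → Fin q,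
      ψ (Fin.cons s w) = mpsWithBoundary (m + 1) A C w) :
    ∃ X : Matrix (Fin D) (Fin D) ℂ, ∀ w, ψ w = mpsWithBoundary (m + 2) A X w := by
  choose B hB using hB
  choose C hC using hC
  have key : ∀ s t : Fin q, B t * A s = A t * C s := by
    intro s t
    refine eq_of_trace_mul_wordProduct_eq hinj fun w => ?_
    have h1 := hB t (Fin.cons s w)
    have h2 := hC s (Fin.snoc w t)
    rw [Fin.cons_snoc_eq_snoc_cons, h1, mpsWithBoundary, mpsWithBoundary, wordProduct_cons,
      wordProduct_snoc] at h2
    rw [Matrix.mul_assoc, h2, Matrix.mul_assoc, trace_mul_cycle']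
  set X : Matrix (Fin D) (Fin D) ℂ := ∑ s, C s * (A s)ᴴ with hX
  have hBt : ∀ t, B t = A t * X := by
    intro t
    calc B t = B t * ∑ s, A s * (A s)ᴴ := by rw [hnorm, Matrix.mul_one]
      _ = ∑ s, A t * (C s * (A s)ᴴ) := by
          rw [Finset.mul_sum]
          exact Finset.sum_congr rfl fun s _ => by rw [← Matrix.mul_assoc, key, Matrix.mul_assoc]
      _ = A t * X := by rw [hX, Finset.mul_sum]
  refine ⟨X, fun w => ?_⟩
  rw [← Fin.snoc_init_self w, hB, mpsWithBoundary, mpsWithBoundary, wordProduct_snoc, hBt,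
    Matrix.mul_assoc, trace_mul_comm, Matrix.mul_assoc]

/-! ### Two-site slices and their restrictions -/

/-- Restricting a vector on `n + 1` sites to a frozen last letter preserves the property that
every nearest-neighbour two-site slice is a two-site boundary MPS. [folklore] -/
theorem twoSiteSlices_snoc {A : MPSTensor q D} {n : ℕ} (ψ : (Fin (n + 1) → Fin q) → ℂ)
    (hψ : ∀ (j : ℕ) (hj : j + 2 ≤ n + 1) (σ : Fin (n + 1) → Fin q),
      ∃ B : Matrix (Fin D) (Fin D) ℂ, ∀ τ : Fin (n + 1) → Fin q,
        (∀ i : Fin (n + 1), i.val ≠ j → i.val ≠ j + 1 → σ i = τ i) →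
          ψ τ = mpsWithBoundary 2 A B (fun i : Fin 2 => τ ⟨j + i, by omega⟩))
    (t : Fin q) :
    ∀ (j : ℕ) (hj : j + 2 ≤ n) (σ : Fin n → Fin q),
      ∃ B : Matrix (Fin D) (Fin D) ℂ, ∀ τ : Fin n → Fin q,
        (∀ i : Fin n, i.val ≠ j → i.val ≠ j + 1 → σ i = τ i) →
          ψ (Fin.snoc τ t) = mpsWithBoundary 2 A B (fun i : Fin 2 => τ ⟨j + i, by omega⟩) := by
  intro j hj σ
  obtain ⟨B, hB⟩ := hψ j (by omega) (Fin.snoc σ t)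
  refine ⟨B, fun τ hτ => ?_⟩
  have h := hB (Fin.snoc τ t) fun i hi hi' => by
    by_cases hil : i = Fin.last n
    · subst hil
      simp [Fin.snoc_last]
    · obtain ⟨i', rfl⟩ := Fin.exists_castSucc_eq.2 hil
      rw [Fin.snoc_castSucc, Fin.snoc_castSucc]
      exact hτ i' hi hi'
  rw [h]
  congr 1
  funext i
  have hi : (⟨j + (i : ℕ), by omega⟩ : Fin (n + 1)) = Fin.castSucc ⟨j + i, by omega⟩ := rfl
  rw [hi, Fin.snoc_castSucc]

/-- Restricting a vector on `n + 1` sites to a frozen first letter preserves the property that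
every nearest-neighbour two-site slice is a two-site boundary MPS (bond `j` of the restriction is
bond `j + 1` of `ψ`). [folklore] -/
theorem twoSiteSlices_cons {A : MPSTensor q D} {n : ℕ} (ψ : (Fin (n + 1) → Fin q) → ℂ)
    (hψ : ∀ (j : ℕ) (hj : j + 2 ≤ n + 1) (σ : Fin (n + 1) → Fin q),
      ∃ B : Matrix (Fin D) (Fin D) ℂ, ∀ τ : Fin (n + 1) → Fin q,
        (∀ i : Fin (n + 1), i.val ≠ j → i.val ≠ j + 1 → σ i = τ i) →
          ψ τ = mpsWithBoundary 2 A B (fun i : Fin 2 => τ ⟨j + i, by omega⟩))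
    (s : Fin q) :
    ∀ (j : ℕ) (hj : j + 2 ≤ n) (σ : Fin n → Fin q),
      ∃ B : Matrix (Fin D) (Fin D) ℂ, ∀ τ : Fin n → Fin q,
        (∀ i : Fin n, i.val ≠ j → i.val ≠ j + 1 → σ i = τ i) →
          ψ (Fin.cons s τ) = mpsWithBoundary 2 A B (fun i : Fin 2 => τ ⟨j + i, by omega⟩) := by
  intro j hj σ
  obtain ⟨B, hB⟩ := hψ (j + 1) (by omega) (Fin.cons s σ)
  refine ⟨B, fun τ hτ => ?_⟩
  have h := hB (Fin.cons s τ) fun i hi hi' => by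
    by_cases hi0 : i = 0
    · subst hi0
      rfl
    · obtain ⟨i', rfl⟩ := Fin.exists_succ_eq.2 hi0
      rw [Fin.cons_succ, Fin.cons_succ]
      refine hτ i' ?_ ?_
      · intro h'; exact hi (by simp [h'])
      · intro h'; exact hi' (by simp [h'])
  rw [h]
  congr 1
  funext i
  have : (⟨j + 1 + (i : ℕ), by omega⟩ : Fin (n + 1)) = Fin.succ ⟨j + i, by omega⟩ :=
    Fin.ext (by simp; omega)
  rw [this, Fin.cons_succ]

/-! ### The open chain: every two-site-exposed vector is a boundary MPS -/

/-- **Kernel of the open-chain parent Hamiltonian (FNW Lemma 5.5, iterated).** Let `A` be a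
tensor whose words of length `2` span `M_D(ℂ)` (interaction length `ℓ₀ ≤ 2`) with
`Σ_s A^s (A^s)† = 𝟙`, and assume the intersection property at `ℓ = 2`
(`𝒢₃ = 𝒢₂ ⊗ ℋ ∩ ℋ ⊗ 𝒢₂`, hypothesis `h3`, which is not automatic: Fannes–Nachtergaele–Werner
(1992) p. 471 and Example 7). Then for every `n ≥ 2`, a vector `ψ` on `n` sites all of whose
nearest-neighbour two-site slices lie in `𝒢₂ = {ψ_B}` is a boundary MPS `ψ_X` on `n` sites:
`⋂_j ℋ^{⊗j} ⊗ 𝒢₂ ⊗ ℋ^{⊗(n-j-2)} = 𝒢_n`. Induction on `n` with `exists_boundary_of_snoc_of_cons`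
(injectivity at length `n - 1 ≥ 2` by `IsInjectiveMPS.of_le`). Fannes–Nachtergaele–Werner,
CMP 144 (1992), Lemma 5.5 (pp. 468–469) and the remark on p. 471.
[cite: FannesNachtergaeleWernerCMP1992, §5 Lemma 5.5] -/
theorem exists_boundary_of_twoSiteSlices {A : MPSTensor q D} (hinj : IsInjectiveMPS A 2)
    (hnorm : ∑ s : Fin q, A s * (A s)ᴴ = 1)
    (h3 : ∀ ψ : (Fin 3 → Fin q) → ℂ,
      (∀ t : Fin q, ∃ B : Matrix (Fin D) (Fin D) ℂ, ∀ w : Fin 2 → Fin q,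
        ψ (Fin.snoc w t) = mpsWithBoundary 2 A B w) →
      (∀ s : Fin q, ∃ C : Matrix (Fin D) (Fin D) ℂ, ∀ w : Fin 2 → Fin q,
        ψ (Fin.cons s w) = mpsWithBoundary 2 A C w) →
      ∃ X : Matrix (Fin D) (Fin D) ℂ, ∀ w, ψ w = mpsWithBoundary 3 A X w)
    (n : ℕ) (hn : 2 ≤ n) (ψ : (Fin n → Fin q) → ℂ)
    (hψ : ∀ (j : ℕ) (hj : j + 2 ≤ n) (σ : Fin n → Fin q),
      ∃ B : Matrix (Fin D) (Fin D) ℂ, ∀ τ : Fin n → Fin q,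
        (∀ i : Fin n, i.val ≠ j → i.val ≠ j + 1 → σ i = τ i) →
          ψ τ = mpsWithBoundary 2 A B (fun i : Fin 2 => τ ⟨j + i, by omega⟩)) :
    ∃ X : Matrix (Fin D) (Fin D) ℂ, ∀ w, ψ w = mpsWithBoundary n A X w := by
  induction n, hn using Nat.le_induction with
  | base =>
    rcases isEmpty_or_nonempty (Fin 2 → Fin q) with hq | hne
    · exact ⟨0, fun w => (IsEmpty.false w).elim⟩
    · obtain ⟨B, hB⟩ := hψ 0 le_rfl hne.some
      refine ⟨B, fun w => ?_⟩
      rw [hB w fun i h0 h1 => absurd i.isLt (by omega)]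
      congr 1
      funext i
      congr 1
      exact Fin.ext (by simp)
  | succ n hn ih =>
    -- boundary data from the induction hypothesis applied to the restrictions
    have hB : ∀ t : Fin q, ∃ B : Matrix (Fin D) (Fin D) ℂ, ∀ w : Fin n → Fin q,
        ψ (Fin.snoc w t) = mpsWithBoundary n A B w := fun t =>
      ih (fun w => ψ (Fin.snoc w t)) (twoSiteSlices_snoc ψ hψ t)
    have hC : ∀ s : Fin q, ∃ C : Matrix (Fin D) (Fin D) ℂ, ∀ w : Fin n → Fin q,
        ψ (Fin.cons s w) = mpsWithBoundary n A C w := fun s =>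
      ih (fun w => ψ (Fin.cons s w)) (twoSiteSlices_cons ψ hψ s)
    obtain ⟨m, rfl⟩ : ∃ m, n = m + 1 := ⟨n - 1, by omega⟩
    rcases Nat.lt_or_ge m 2 with hm | hm
    · obtain rfl : m = 1 := by omega
      exact h3 ψ hB hC
    · exact exists_boundary_of_snoc_of_cons (hinj.of_le two_pos hm) hnorm ψ hB hC

end QLattice

end Literature.MathematicalPhysics.QuantumLattice
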